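import Summits.CriticalPhenomena.SAWScalingLimit.Theorems.HexTight.Negative.LatticeG2Routes

/-!
# Negative lemma for crux `HexTight` (stmt-CriticalPhenomena-5423): the lattice Condition G2
over ALL finite hexagonal domains is false (ring counterexample)

cdisprove generation 3 (2026-08-16). The line `Cruxes/HexTight/Lines/tip-renewal-complementarity.lean`
composes `HexTight` through `LatticeG2` (= `LatticeG2With fun _ => True`: Kemppainen–Smirnov's
Condition G2 in CONSTANT form for the pinned critical SAW, quantified over EVERY finite domain
`Λ : Finset HexVertex`, holes allowed — it is the conclusion of `stub_floatingPast : LatticeG2SC →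
LatticeG2` and the hypothesis of `stub_traversalBound_of : LatticeG2 → …`). Crux work files cannot be
imported into `Theorems/`, so the definitions are reproduced VERBATIM below (`LatticeG2AsTyped`).

**`LatticeG2AsTyped` is false** (`not_latticeG2AsTyped`), for a purely TOPOLOGICAL reason that needs
no estimate: take for `Λ` a large RING of cells (a closed zigzag: bottom row through the source
vertex `v₀`, two far columns, a far top row through the target vertex `v₁`), the source mid-edge
`t = {u₀, v₀}` at the centre `x = c(v₀)` of the annulus `A(x; r, R)` and the target `z = {u₁, v₁}`
beyond it. EVERY arc `t → z` crosses the annulus (from `dist ≤ r` to `dist ≥ R`) inside ONE of the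
two bottom arms `A₊` (right) / `A₋` (left), which are different annulus components (cells of `Λ` in
the annulus have `|Re c(y) - Re x| ≥ 1/2` with a definite sign, adjacent cells differ by `≤ 1/2` in
real part), and each arm is UNFORCED — `v₀` and `v₁` are joined in `Λ` minus that arm by the route
through the other arm. Hence the unforced-crossing mass `arcMassIf … (UnforcedCrossing …)` EQUALS the
total mass `arcMass … > 0`, and no `q < 1` works, whatever `C > 1` and the cutoff `n₁`.

MORAL (for the provers of every Kemppainen–Smirnov-type line). With HOLES in the domain (floating
pasts, or any finite `Λ` as typed) an "unforced" crossing need not be a U-turn: the alternative route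
may go the other way round the hole, and then conditional G2 in constant form fails outright; with an
ASYMMETRIC ring the `x_c^{ℓ}` weights even make the cheap arm carry mass fraction `→ 1`. What
survives: (i) SIMPLY CONNECTED slit domains (`LatticeG2SC`: a cross-cut separates, an unforced
crossing is half of a double crossing = U-turn — the line's SIDES LEMMA), (ii) the U-turn /
double-crossing statements (`TipNoReturn`, `CoherentDecay`, `PinnedDecoupling`), (iii) annealed
Aizenman–Burchard bounds for the actual law (`HexTraversalBound`) and the virgin-disc statements of
the line `reversal-virgin-disc`. Consequence for the skeleton: `stub_floatingPast` is equivalent to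
`¬ LatticeG2SC`, so the seven stubs of `tip-renewal-complementarity` are jointly inconsistent with
the intended truth of `LatticeG2SC`; S6/S7 must be re-typed (restrict `LatticeG2` to slit domains of
simply connected domains with at most the walk's own floating past, or feed S7 from `LatticeG2SC`).
-/

noncomputable section

open scoped BigOperators
open Classical
open Literature.Probability.LatticeModels
open Literature.Probability.RandomPlanarGeometry.SAW

namespace Summit.CriticalPhenomena.SAWScalingLimit.Cruxes.HexTight.Negative

/-! ## Crossing extraction: every chain from the inner ball to beyond the annulus crosses it -/

/-- the first element of a `dropWhile` fails the predicate -/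
theorem dropWhile_eq_cons_imp {α : Type*} {P : α → Bool} :
    ∀ {l : List α} {w : α} {l₃ : List α}, w :: l₃ = l.dropWhile P → P w = false
  | [], _, _, h => by simp at h
  | a :: l, w, l₃, h => by
    rw [List.dropWhile_cons] at h
    by_cases ha : P a = true
    · rw [if_pos ha] at h
      exact dropWhile_eq_cons_imp h
    · rw [if_neg ha] at h
      rw [(List.cons.inj h).1]
      simpa using ha

/-- **Crossing extraction.** A lattice chain from within `r` of `x` to beyond `R > r + 1` contains a
block `u, u', …, w` with `dist u ≤ r`, `dist w ≥ R` and all cells strictly between (at least one: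
`u`, `w` are not adjacent) in the open annulus. -/
theorem exists_crossing {l : List HexVertex} (hl : l ≠ []) (hch : l.IsChain hexGraph.Adj)
    {x : ℂ} {r R : ℝ} (hrR : r + 1 < R)
    (h0 : dist (hexCenter (l.head hl)) x ≤ r) (h1 : R ≤ dist (hexCenter (l.getLast hl)) x) :
    ∃ (l₁ l₂ l₃ : List HexVertex) (u u' w : HexVertex),
      l = l₁ ++ u :: u' :: l₂ ++ w :: l₃ ∧ dist (hexCenter u) x ≤ r ∧ R ≤ dist (hexCenter w) x ∧
      (u' :: l₂).IsChain hexGraph.Adj ∧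
      ∀ y ∈ u' :: l₂, r < dist (hexCenter y) x ∧ dist (hexCenter y) x < R := by
  -- split at the first cell beyond `R`
  set P : HexVertex → Bool := fun y => decide (dist (hexCenter y) x < R) with hP
  set p := l.takeWhile P with hp
  set q := l.dropWhile P with hq
  have hpq : p ++ q = l := List.takeWhile_append_dropWhile
  have hp_lt : ∀ y ∈ p, dist (hexCenter y) x < R := fun y hy => by
    have h := List.mem_takeWhile_imp (p := P) hy
    simpa [hP] using h
  have hq_ne : q ≠ [] := by
    intro hq0
    have hall := (List.dropWhile_eq_nil_iff.1 hq0) (l.getLast hl) (List.getLast_mem hl)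
    have hall' : dist (hexCenter (l.getLast hl)) x < R := by simpa [hP] using hall
    exact absurd hall' (not_lt.2 h1)
  obtain ⟨w, l₃, hw⟩ := List.exists_cons_of_ne_nil hq_ne
  have hw_ge : R ≤ dist (hexCenter w) x := by
    have := dropWhile_eq_cons_imp (hq.symm.trans hw).symm
    simpa [hP] using this
  have hp_ne : p ≠ [] := by
    intro hp0
    rw [hp0, List.nil_append] at hpq
    have : l.head hl = w := by simp [← hpq, hw]
    rw [this] at h0
    linarith
  -- inside `p`, split at the last cell within `r`
  set Q : HexVertex → Bool := fun y => decide (r < dist (hexCenter y) x) with hQ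
  set a := p.reverse.takeWhile Q with ha
  set b := p.reverse.dropWhile Q with hb
  have hab : a ++ b = p.reverse := List.takeWhile_append_dropWhile
  have ha_gt : ∀ y ∈ a, r < dist (hexCenter y) x := fun y hy => by
    have h := List.mem_takeWhile_imp (p := Q) hy
    simpa [hQ] using h
  have hhead : l.head hl = p.head hp_ne := by
    have h1 : l.head? = some (p.head hp_ne) := by
      rw [← hpq, List.head?_append, List.head?_eq_some_head hp_ne]; rfl
    rw [List.head?_eq_some_head hl, Option.some.injEq] at h1
    exact h1
  have hb_ne : b ≠ [] := by
    intro hb0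
    have hall := (List.dropWhile_eq_nil_iff.1 hb0) (p.head hp_ne)
      (List.mem_reverse.2 (List.head_mem hp_ne))
    rw [← hhead] at hall
    have hall' : r < dist (hexCenter (l.head hl)) x := by simpa [hQ] using hall
    exact absurd hall' (not_lt.2 h0)
  obtain ⟨u, s, hu⟩ := List.exists_cons_of_ne_nil hb_ne
  have hu_le : dist (hexCenter u) x ≤ r := by
    have := dropWhile_eq_cons_imp (hb.symm.trans hu).symm
    simpa [hQ] using this
  have hp_eq : p = s.reverse ++ u :: a.reverse := by
    have : p = (a ++ b).reverse := by rw [hab, List.reverse_reverse]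
    rw [this, hu, List.reverse_append, List.reverse_cons, List.append_assoc, List.singleton_append]
  have hl_eq : l = s.reverse ++ u :: (a.reverse ++ w :: l₃) := by
    rw [← hpq, hp_eq, hw, List.append_assoc, List.cons_append]
  -- the middle block is nonempty: `u` and `w` are not adjacent
  have ha_ne : a.reverse ≠ [] := by
    intro ha0
    rw [ha0, List.nil_append] at hl_eq
    have hch' := hch
    rw [hl_eq] at hch'
    have huw : hexGraph.Adj u w := (List.isChain_cons_cons.1 hch'.right_of_append).1
    have hd := (re_sub_re_of_adj huw).2
    have := dist_triangle (hexCenter w) (hexCenter u) x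
    rw [dist_comm (hexCenter w) (hexCenter u)] at this
    linarith
  obtain ⟨u', l₂, hu'⟩ := List.exists_cons_of_ne_nil ha_ne
  rw [hu'] at hl_eq
  refine ⟨s.reverse, l₂, l₃, u, u', w, ?_, hu_le, hw_ge, ?_, ?_⟩
  · rw [hl_eq]; simp
  · have hch' := hch
    rw [hl_eq] at hch'
    have h2 : (u' :: l₂ ++ w :: l₃).IsChain hexGraph.Adj :=
      (List.isChain_cons.1 hch'.right_of_append).2
    exact h2.left_of_append
  · intro y hy
    have hya : y ∈ a := by rw [← List.mem_reverse, hu']; exact hy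
    have hyp : y ∈ p := by
      rw [hp_eq]
      exact List.mem_append_right _ (List.mem_cons_of_mem _ (List.mem_reverse.2 hya))
    exact ⟨ha_gt y hya, hp_lt y hyp⟩

/-! ## From a lattice path to a mid-edge self-avoiding walk -/

/-- the members of an edge of the edge list of `l` are members of `l` -/
theorem mem_of_mem_zipWith : ∀ (l : List HexVertex), ∀ e ∈ List.zipWith (fun u w => s(u, w)) l l.tail,
    ∀ c ∈ e, c ∈ l
  | [], e, he, _, _ => by simp at he
  | [a], e, he, _, _ => by simp at he
  | a :: b :: l, e, he, c, hc => by
    rw [List.tail_cons, List.zipWith_cons_cons, List.mem_cons] at he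
    rcases he with rfl | he
    · rcases Sym2.mem_iff.1 hc with rfl | rfl <;> simp
    · exact List.mem_cons_of_mem _ (mem_of_mem_zipWith (b :: l) e he c hc)

/-- a duplicate-free vertex list has a duplicate-free edge list -/
theorem nodup_zipWith : ∀ (l : List HexVertex), l.Nodup →
    (List.zipWith (fun u w => s(u, w)) l l.tail).Nodup
  | [], _ => by simp
  | [a], _ => by simp
  | a :: b :: l, h => by
    rw [List.tail_cons, List.zipWith_cons_cons, List.nodup_cons]
    rw [List.nodup_cons] at h
    refine ⟨fun hmem => h.1 ?_, nodup_zipWith (b :: l) h.2⟩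
    exact mem_of_mem_zipWith (b :: l) _ hmem a (Sym2.mem_mk_left _ _)

/-- A lattice path inside `Λ` between the `Λ`-endpoints of two distinct boundary mid-edges gives a
mid-edge self-avoiding walk of `Λ` between them. -/
theorem nonempty_saw {Λ : Finset HexVertex} {u₀ v₀ u₁ v₁ : HexVertex}
    (hj : LatticeJoined (↑Λ : Set HexVertex) v₀ v₁) (h₀ : hexGraph.Adj u₀ v₀) (hu₀ : u₀ ∉ Λ)
    (hu₁ : u₁ ∉ Λ) (hne : s(u₀, v₀) ≠ s(u₁, v₁)) :
    Nonempty (HexMidEdgeSAW Λ s(u₀, v₀) s(u₁, v₁)) := by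
  obtain ⟨p, hp⟩ := hj
  set w := p.bypass with hw
  have hsub : ∀ y ∈ w.support, y ∈ Λ := fun y hy =>
    Finset.mem_coe.1 (hp y (p.support_bypass_subset_support hy))
  have hv₀ : v₀ ∈ Λ := Finset.mem_coe.1 (hp _ p.start_mem_support)
  have hne_nil : w.support ≠ [] := SimpleGraph.Walk.support_ne_nil _
  have hZ : ∀ e ∈ List.zipWith (fun u w => s(u, w)) w.support w.support.tail, ∀ c ∈ e, c ∈ Λ :=
    fun e he c hc => hsub c (mem_of_mem_zipWith _ e he c hc)
  refine ⟨{ verts := w.support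
            subset := hsub
            nodup := p.bypass_isPath.support_nodup
            isChain := w.isChain_adj_support
            head_mem := fun v hv => ?_
            getLast_mem := fun v hv => ?_
            eq_of_nil := fun h => (hne_nil h).elim
            edges_nodup := fun _ => ?_
            fst_mem := ⟨(SimpleGraph.mem_edgeSet hexGraph).2 h₀, v₀, Sym2.mem_mk_right _ _, hv₀⟩ }⟩
  · have hs : w.support = v₀ :: w.support.tail := (SimpleGraph.Walk.cons_tail_support w).symm
    rw [hs, List.head?_cons, Option.some.injEq] at hv
    rw [← hv]; exact Sym2.mem_mk_right _ _
  · rw [List.getLast?_eq_some_getLast hne_nil, Option.some.injEq, SimpleGraph.Walk.getLast_support]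
      at hv
    rw [← hv]; exact Sym2.mem_mk_right _ _
  · rw [List.cons_append, List.nodup_cons]
    refine ⟨fun hmem => ?_, ?_⟩
    · rcases List.mem_append.1 hmem with hmem | hmem
      · exact hu₀ (hZ _ hmem u₀ (Sym2.mem_mk_left _ _))
      · exact hne (List.mem_singleton.1 hmem)
    · rw [← List.concat_eq_append]
      refine List.Nodup.concat (fun hmem => ?_) (nodup_zipWith _ p.bypass_isPath.support_nodup)
      exact hu₁ (hZ _ hmem u₁ (Sym2.mem_mk_left _ _))

/-! ## The refutation -/

/-- distance of the outside neighbour `D(0,-1)` of the source vertex to the centre: `1/√3 ≤ 1` -/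
theorem dist_D0m1_le : dist (hexCenter (D 0 (-1))) x₀ ≤ 1 := by
  have h3 : Real.sqrt 3 ^ 2 = 3 := Real.sq_sqrt (by norm_num)
  rw [Complex.dist_eq, ← sq_le_one_iff₀ (norm_nonneg _), Complex.sq_norm, Complex.normSq_apply,
    Complex.sub_re, Complex.sub_im, re_D, im_D, x₀_re, x₀_im]
  push_cast
  nlinarith [h3]

/-- **Lattice Condition G2 over all finite domains is FALSE** (ring counterexample; see the module
docstring). Refutes the conclusion of `stub_floatingPast` / the hypothesis of `stub_traversalBound_of`
of the line `tip-renewal-complementarity` for crux `HexTight` (stmt-CriticalPhenomena-5423). -/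
theorem not_latticeG2AsTyped : ¬ LatticeG2AsTyped := by
  rintro ⟨C, q, n₁, hC, hq, h⟩
  -- radii and the size of the ring
  set r : ℝ := max (n₁ : ℝ) 1 with hr
  have hr1 : 1 ≤ r := le_max_right _ _
  have hrn : (n₁ : ℝ) ≤ r := le_max_left _ _
  set R : ℝ := C * r + 1 with hR
  have hCr : C * r ≤ R := by rw [hR]; linarith
  have hrR : r + 1 < R := by rw [hR]; nlinarith
  set K : ℕ := ⌈R⌉₊ with hK
  have hRK : R ≤ K := Nat.le_ceil _
  have hK1 : 1 ≤ K := by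
    have : (1 : ℝ) ≤ K := by linarith
    exact_mod_cast this
  -- the data
  have hv₀ : U 0 0 ∈ ring K := U_mem_ring.2 (Or.inl ⟨rfl, by omega, by omega⟩)
  have hu₀ : D 0 (-1) ∉ ring K := fun hm => by
    rcases D_mem_ring.1 hm with hm | hm | hm | hm <;> omega
  have hv₁ : U 0 (2 * K) ∈ ring K := U_mem_ring.2 (Or.inr (Or.inr (Or.inl ⟨rfl, by omega, by omega⟩)))
  have hu₁ : D 0 (2 * K - 1) ∉ ring K := fun hm => by
    rcases D_mem_ring.1 hm with hm | hm | hm | hm <;> omega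
  have hadj₀ : hexGraph.Adj (D 0 (-1)) (U 0 0) := by
    have := adj_U_Dd 0 0
    rw [zero_sub] at this
    exact this.symm
  have hadj₁ : hexGraph.Adj (D 0 (2 * K - 1)) (U 0 (2 * K)) := by
    have := adj_D_Uu 0 (2 * (K : ℤ) - 1)
    rwa [sub_add_cancel] at this
  have hne : s(D 0 (-1), U 0 0) ≠ s(D 0 (2 * (K : ℤ) - 1), U 0 (2 * K)) := by
    intro he
    rcases Sym2.eq_iff.1 he with ⟨-, he⟩ | ⟨he, -⟩
    · have := (U_inj he).2; omega
    · exact U_ne_D _ _ _ _ he.symm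
  have hinner : ∃ y : HexVertex, y ∉ ring K ∧ dist (hexCenter y) x₀ ≤ r :=
    ⟨D 0 (-1), hu₀, dist_D0m1_le.trans hr1⟩
  have key := h (ring K) trivial (D 0 (-1)) (U 0 0) (D 0 (2 * K - 1)) (U 0 (2 * K)) hu₀ hv₀ hadj₀
    hu₁ hv₁ hadj₁ hne x₀ r R hrn hCr hinner
  -- annulus cells obey the dichotomy
  have hS : ∀ y ∈ annVerts (ring K) x₀ r R,
      x₀.re + 1 / 2 ≤ (hexCenter y).re ∨ (hexCenter y).re ≤ x₀.re - 1 / 2 := fun y hy =>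
    re_dichotomy hy.1 (by linarith [hy.2.1]) (by linarith [hy.2.2])
  -- every arc `t → z` makes an unforced crossing
  have hall : ∀ γ : HexMidEdgeSAW (ring K) s(D 0 (-1), U 0 0) s(D 0 (2 * (K : ℤ) - 1), U 0 (2 * K)),
      UnforcedCrossing (ring K) (U 0 0) (U 0 (2 * K)) x₀ r R γ.verts := by
    intro γ
    have hne_nil : γ.verts ≠ [] := fun h0 => hne (γ.eq_of_nil h0)
    have hhead : γ.verts.head hne_nil = U 0 0 := by
      have hm := γ.head_mem (γ.verts.head hne_nil) (List.head?_eq_some_head hne_nil)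
      rcases Sym2.mem_iff.1 hm with hm | hm
      · exact absurd (hm ▸ γ.subset _ (List.head_mem hne_nil)) hu₀
      · exact hm
    have hlast : γ.verts.getLast hne_nil = U 0 (2 * K) := by
      have hm := γ.getLast_mem (γ.verts.getLast hne_nil) (List.getLast?_eq_some_getLast hne_nil)
      rcases Sym2.mem_iff.1 hm with hm | hm
      · exact absurd (hm ▸ γ.subset _ (List.getLast_mem hne_nil)) hu₁
      · exact hm
    have h0 : dist (hexCenter (γ.verts.head hne_nil)) x₀ ≤ r := by
      rw [hhead, show hexCenter (U 0 0) = x₀ from rfl, dist_self]; linarith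
    have h1 : R ≤ dist (hexCenter (γ.verts.getLast hne_nil)) x₀ := by
      rw [hlast]
      refine hRK.trans (far_of_mem_ring hv₁ ?_)
      show (2 * (K : ℤ)) ≠ 0
      omega
    obtain ⟨l₁, l₂, l₃, u, u', w, heq, hu, hw, hchain, hann⟩ :=
      exists_crossing hne_nil γ.isChain hrR h0 h1
    have hmemΛ : ∀ y ∈ u' :: l₂, y ∈ ring K := fun y hy => by
      refine γ.subset y ?_
      rw [heq]
      rcases List.mem_cons.1 hy with rfl | hy
      · simp
      · simp [hy]
    have hannV : ∀ y ∈ u' :: l₂, y ∈ annVerts (ring K) x₀ r R := fun y hy =>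
      ⟨hmemΛ y hy, hann y hy⟩
    have hu'V : u' ∈ annVerts (ring K) x₀ r R := hannV u' (by simp)
    refine ⟨u', hu'V, ⟨l₁, l₂, l₃, u, u', w, heq, Or.inl ⟨hu, hw⟩, fun y hy => ?_⟩, ?_⟩
    · exact latticeJoined_of_isChain u' l₂ hchain hannV y hy
    · -- the other way round avoids the component of `u'`
      rcases hS u' hu'V with hpos | hneg
      · have hcomp : ∀ y ∈ annComp (ring K) x₀ r R u', x₀.re < (hexCenter y).re ∧
            y ∈ annVerts (ring K) x₀ r R := fun y hy =>
          ⟨re_pos_of_latticeJoined hS hy (by linarith), LatticeJoined.mem_right hy⟩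
        refine (joined_left hK1).mono fun y hy => ⟨hy.1, fun hyc => ?_⟩
        obtain ⟨hyre, hyV⟩ := hcomp y hyc
        rcases hy.2 with hle | htop
        · linarith
        · have hfar := far_of_mem_ring hy.1 (by rw [htop]; omega)
          linarith [hyV.2.2]
      · have hcomp : ∀ y ∈ annComp (ring K) x₀ r R u', (hexCenter y).re < x₀.re := fun y hy =>
          re_neg_of_latticeJoined hS hy (by linarith)
        refine (joined_right hK1).mono fun y hy => ⟨hy.1, fun hyc => ?_⟩
        have := hcomp y hyc
        have := hy.2
        linarith
  -- hence the unforced-crossing mass is the whole (positive) mass: contradiction with `q < 1`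
  have heq : arcMassIf (ring K) s(D 0 (-1), U 0 0) s(D 0 (2 * (K : ℤ) - 1), U 0 (2 * K))
      (UnforcedCrossing (ring K) (U 0 0) (U 0 (2 * K)) x₀ r R) =
      arcMass (ring K) s(D 0 (-1), U 0 0) s(D 0 (2 * (K : ℤ) - 1), U 0 (2 * K)) :=
    Finset.sum_congr rfl fun γ _ => if_pos (hall γ)
  have hpos : 0 < arcMass (ring K) s(D 0 (-1), U 0 0) s(D 0 (2 * (K : ℤ) - 1), U 0 (2 * K)) := by
    obtain ⟨γ⟩ := nonempty_saw ((joined_right hK1).mono fun y hy => Finset.mem_coe.2 hy.1)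
      hadj₀ hu₀ hu₁ hne
    have hx := hexCriticalFugacity_pos_lt_one
    exact lt_of_lt_of_le (pow_pos hx.1 γ.length)
      (Finset.single_le_sum (f := fun γ' : HexMidEdgeSAW (ring K) s(D 0 (-1), U 0 0)
        s(D 0 (2 * (K : ℤ) - 1), U 0 (2 * K)) => hexCriticalFugacity ^ γ'.length)
        (fun γ' _ => pow_nonneg hx.1.le _) (Finset.mem_univ γ))
  rw [heq] at key
  nlinarith


end Summit.CriticalPhenomena.SAWScalingLimit.Cruxes.HexTight.Negative

end
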